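import Summits.FinalStateConjecture.FinalStateConjecture.Theses.ZeroEnergyKerrOrBomb
import Summits.FinalStateConjecture.FinalStateConjecture.Theorems.ZeroEnergyKerrOrBombKerrOrBombOfCruxes
import Summits.FinalStateConjecture.FinalStateConjecture.Theorems.ZeroEnergyKerrOrBombErgoregionBomb

/-!
# Crux `KerrOrBomb` (stmt-FinalStateConjecture-10689) — line `Dock`: the dock, fact-free

Helper file of the line lead (prover-line-stmt-FinalStateConjecture-10689-0, 2026-08-16) for the
registered skeleton `Cruxes/KerrOrBomb/Lines/Dock.lean`, `--supports stmt-FinalStateConjecture-10689`.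

* `kerrOrBomb_of_zeroEnergyRigidity : ZeroEnergyRigidity → KerrOrBomb` — the crux from the sibling
  crux stmt-FinalStateConjecture-10690 ALONE, through the landed glue `KerrOrBombOfCruxes_proof`
  (support item `KerrOrBombOfCruxes`) and the landed `ErgoregionBomb_of`
  (`Theorems/ZeroEnergyKerrOrBombErgoregionBomb.lean`, which closed item
  stmt-FinalStateConjecture-10691 — vacuously: its trapping clause imprisons a null geodesic ray in
  a compact subset of a globally hyperbolic carrier, impossible by Bernal–Sánchez + non-imprisonment
  + endlessness of geodesic rays, `Literature/Geometry/Lorentzian/GeodesicRayEndless.lean`; the two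
  lines met on that last lemma and share it).

So, AS TYPED, the crux hinges on item 10690 only: when `ZeroEnergyRigidity_holds` is appended to the
route file, `KerrOrBomb` follows by `kerrOrBomb_of_zeroEnergyRigidity ZeroEnergyRigidity_holds`.
Killing-mode stability (h6) is never used and the "Kerr or bomb" dichotomy is not exercised
(Disproof F2/F6: as typed the crux is `CoreRigidityGH` with idle h5/h6; the intended dichotomy needs
the planner's restate through `StationaryAFBlackHole.HasZeroEnergyRayTrappedModFlow`).

Revision 3 (reviews of p88017, p91775): no re-proof of `ErgoregionBomb`, no re-export of the two
Literature theorems that closed the line's analytic stubs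
(`Literature.Analysis.ODE.exists_lt_norm_of_norm_accel_le_mul_sq`,
`Literature.Geometry.Lorentzian.IsGeodesicOn.not_tendsto_nhds_of_velocity_ne_zero`) — consumers import
those directly.
-/

noncomputable section

-- `Summit.FinalStateConjecture.FinalStateConjecture.…`: summit = problem name (single-conjunct summit, D-0017).
set_option linter.dupNamespace false

namespace Summit.FinalStateConjecture.FinalStateConjecture.Theorems.KerrOrBombDock

/-- **The dock: `KerrOrBomb` from the sibling crux `ZeroEnergyRigidity` alone** (item
stmt-FinalStateConjecture-10690), through the landed glue `KerrOrBombOfCruxes_proof` and the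
landed `ErgoregionBomb_of` (item stmt-FinalStateConjecture-10691, closed).  No hypothesis of the
crux other than global hyperbolicity (h4, inside `ErgoregionBomb_of`) is touched on the way; in
particular Killing-mode stability (h6) is never used. -/
theorem kerrOrBomb_of_zeroEnergyRigidity :
    Summit.FinalStateConjecture.FinalStateConjecture.Theses.ZeroEnergyKerrOrBomb.ZeroEnergyRigidity →
      Summit.FinalStateConjecture.FinalStateConjecture.Theses.ZeroEnergyKerrOrBomb.KerrOrBomb :=
  fun h ↦ KerrOrBombOfCruxes_proof h ErgoregionBomb_of

end Summit.FinalStateConjecture.FinalStateConjecture.Theorems.KerrOrBombDock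

end
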